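import Mathlib
import HarnessLib
import Summits.ValiantsHypothesis.ValiantsHypothesis.Theorems.SymmetryDialAffineOrbits
import Summits.ValiantsHypothesis.ValiantsHypothesis.Theorems.SymmetryDialTranslationOrbits
import Summits.ValiantsHypothesis.ValiantsHypothesis.Theorems.SymmetryDialDisalignedCFI

/-!
# SymmetryDial — disaligned compact CFI: the displacement profile is twist-blind (NODE-g9 (F2))

Route `SymmetryDial`, workshop `decomp-valiant`, lens 1, gen 9; instrument side of item 23711 (LADDER-Valiant rung 0,
nothing here bears on VP ≠ VNP).  The DISPLACEMENT PROFILE of a `0/1` matrix `M` on `𝔽₂^d`,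
`dispCount M w = #{x : M(x, x + w)}`, is the `C²` / Weisfeiler–Leman-dimension-2 counting instrument that separated
the fibred-translation family LTCFI of NODE-g6 ((δ), (δ′): there the count on an edge displacement is `2^r` or `0`
according to the twist).  For the DISALIGNED compact CFI matrices `cfiMat D S t` of
`SymmetryDialDisalignedCFI` (p763472) it is blind:

* `dispCount_cfiMat_eq` — for every GOOD design `D`, every decoration `S`, every displacement `w` and ANY two
  twists `t, t'`: `dispCount (cfiMat D S t) w = dispCount (cfiMat D S t') w`.
* `dispCount_untwisted_eq_twisted` — the instance for the pair of the conjecture `DisalignedPebble`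
  (untwisted vs one edge twisted).

Proof: if `base w` is not a generator the entries `M(x, x+w)` do not involve the twist at all; if `base w = gen i`
then, fibre by fibre, the entry is `[(λ_{u,i} + λ_{u+gᵢ,i})(a) = const_t]` with `λ_{u,i} + λ_{u+gᵢ,i} ≠ 0` — this
IS disalignment — and the translation `x ↦ x + (0, s_u)` with `(λ_{u,i} + λ_{u+gᵢ,i})(s_u) = 1` is a fixed-point-free
involution exchanging the entries `1` and `0`, so exactly half of the `2^{d₀+r}` points count, for every twist.
-/

set_option linter.dupNamespace false

namespace Summit.ValiantsHypothesis.ValiantsHypothesis.Theorems.SymmetryDialDisalignedCFIDisplacement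

open Finset
open SymmetryDialAffinePebble (V pair)
open SymmetryDialAffineOrbits (add_self)
open SymmetryDialTranslationOrbits (fin2_ne_zero_iff pair_add exists_pair_eq_one)
open SymmetryDialDisalignedCFI (base fib Design cfiMat twist1)

variable {d₀ r δ : ℕ}

/-! ## §1 Small algebra on `𝔽₂`-vectors (the rest is reused from `SymmetryDialTranslationOrbits` / `SymmetryDialAffineOrbits`) -/

/-- `a + b = 0 ↔ a = b` in `𝔽₂`. -/
theorem fin2_add_eq_zero_iff (a b : Fin 2) : a + b = 0 ↔ a = b := by revert a b; decide

/-- `a + 1 = b ↔ a ≠ b` in `𝔽₂`. -/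
theorem fin2_add_one_eq_iff (a b : Fin 2) : a + 1 = b ↔ ¬ a = b := by revert a b; decide

/-- `pair` is additive in the dual vector. -/
theorem pair_add_left {d : ℕ} (ξ η v : V d) : pair (ξ + η) v = pair ξ v + pair η v := by
  unfold pair; rw [← sum_add_distrib]; exact sum_congr rfl fun i _ => by simp [add_mul]

/-! ## §2 Base / fibre bookkeeping -/

/-- `base` is additive (definitionally). -/
theorem base_add (x w : V (d₀ + r)) : base (x + w) = base x + base w := rfl

/-- `fib` is additive (definitionally). -/
theorem fib_add (x w : V (d₀ + r)) : fib (x + w) = fib x + fib w := rfl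

/-- `base` of an appended vector. -/
theorem base_append (a : V d₀) (b : V r) : base (Fin.append a b : V (d₀ + r)) = a := by
  funext i; simp [base, Fin.append_left]

/-- `fib` of an appended vector. -/
theorem fib_append (a : V d₀) (b : V r) : fib (Fin.append a b : V (d₀ + r)) = b := by
  funext j; simp [fib, Fin.append_right]

/-- The entries of `cfiMat`, as a proposition. -/
theorem cfiMat_apply (D : Design d₀ r δ) (S : V d₀ → V r → Bool) (t : V d₀ → V d₀ → Fin 2)
    (x y : V (d₀ + r)) :
    cfiMat D S t (x, y) = true ↔
      (base x = base y ∧ S (base x) (fib x + fib y) = true) ∨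
        ∃ i : Fin δ, base y = base x + D.gen i ∧
          pair (D.lam (base x) i) (fib x) + pair (D.lam (base y) i) (fib y) = t (base x) (base y) := by
  unfold cfiMat
  simp only [Bool.or_eq_true, Bool.and_eq_true, decide_eq_true_eq]

/-! ## §3 The displacement count and a halving lemma -/

/-- Displacement count of a `0/1` matrix on `𝔽₂^d`: `#{x : M(x, x + w)}` (the WL-dimension-2 instrument). -/
def dispCount {d : ℕ} (M : V d × V d → Bool) (w : V d) : ℕ :=
  (univ.filter fun x : V d => M (x, x + w) = true).card

/-- A fixed-point-free involution that flips membership halves the universe. -/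
theorem two_mul_card_eq_of_flip {α : Type*} [Fintype α] [DecidableEq α] (A : Finset α) (τ : α → α)
    (hτ : ∀ x, τ (τ x) = x) (hA : ∀ x, x ∈ A ↔ τ x ∉ A) : 2 * A.card = Fintype.card α := by
  have h1 : A.card = Aᶜ.card := by
    refine Finset.card_bij' (fun x _ => τ x) (fun x _ => τ x) ?_ ?_ ?_ ?_
    · intro x hx; rw [Finset.mem_compl]; exact (hA x).1 hx
    · intro x hx
      rw [Finset.mem_compl] at hx
      exact (hA (τ x)).2 (by rw [hτ]; exact hx)
    · intro x _; exact hτ x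
    · intro x _; exact hτ x
  have h2 := Finset.card_compl A
  have h3 : A.card ≤ Fintype.card α := Finset.card_le_univ A
  omega

/-! ## §4 The theorem -/

/-- **(F2) The displacement profile is twist-blind on every good disaligned design.** -/
theorem dispCount_cfiMat_eq (D : Design d₀ r δ) (hD : D.Good) (S : V d₀ → V r → Bool)
    (t t' : V d₀ → V d₀ → Fin 2) (w : V (d₀ + r)) :
    dispCount (cfiMat D S t) w = dispCount (cfiMat D S t') w := by
  classical
  obtain ⟨_, hinj, hne, _, _, hdis⟩ := hD
  by_cases hw : ∃ i, D.gen i = base w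
  · -- `base w = gen i`: exactly half of the points count, for every twist
    obtain ⟨i, hi⟩ := hw
    have hw0 : base w ≠ 0 := fun h => hne i (hi.trans h)
    -- the edge functional `β_u = λ_{u,i} + λ_{u+gᵢ,i}` is nonzero (disalignment): pick a coordinate where it is 1
    have hβ : ∀ u : V d₀, ∃ s : V r, pair (D.lam u i + D.lam (u + D.gen i) i) s = 1 := by
      intro u
      refine exists_pair_eq_one ?_
      intro h0
      apply hdis u i
      funext j
      have := congrFun h0 j
      simp only [Pi.add_apply, Pi.zero_apply] at this
      exact (fin2_add_eq_zero_iff _ _).1 this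
    choose J hJ using hβ
    -- the involution `x ↦ x + (0, J (base x))`
    let e : V d₀ → V (d₀ + r) := fun u => Fin.append (0 : V d₀) (J u)
    have base_e : ∀ u, base (e u) = 0 := fun u => base_append _ _
    have fib_e : ∀ u, fib (e u) = J u := fun u => fib_append _ _
    let τ : V (d₀ + r) → V (d₀ + r) := fun x => x + e (base x)
    have base_τ : ∀ x, base (τ x) = base x := by
      intro x; show base (x + e (base x)) = base x; rw [base_add, base_e, add_zero]
    have hττ : ∀ x, τ (τ x) = x := by
      intro x
      show x + e (base x) + e (base (x + e (base x))) = x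
      rw [base_add, base_e, add_zero, add_assoc, add_self, add_zero]
    -- the entry at displacement `w`, fibrewise
    have entry : ∀ (t₁ : V d₀ → V d₀ → Fin 2) (x : V (d₀ + r)),
        cfiMat D S t₁ (x, x + w) = true ↔
          pair (D.lam (base x) i) (fib x) + pair (D.lam (base x + D.gen i) i) (fib x + fib w) =
            t₁ (base x) (base x + D.gen i) := by
      intro t₁ x
      rw [cfiMat_apply, base_add, fib_add, ← hi]
      constructor
      · rintro (⟨h1, _⟩ | ⟨i', hi', h⟩)
        · exact absurd (add_left_cancel (h1.symm.trans (add_zero _).symm)) (hne i)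
        · have : i' = i := hinj (add_left_cancel hi').symm
          subst this; exact h
      · intro h; exact Or.inr ⟨i, rfl, h⟩
    have flip : ∀ (t₁ : V d₀ → V d₀ → Fin 2) (x : V (d₀ + r)),
        (cfiMat D S t₁ (x, x + w) = true ↔ ¬ cfiMat D S t₁ (τ x, τ x + w) = true) := by
      intro t₁ x
      rw [entry, entry, base_τ]
      have hfib : fib (τ x) = fib x + J (base x) := by
        show fib (x + e (base x)) = _; rw [fib_add, fib_e]
      rw [hfib]
      have hs : pair (D.lam (base x) i) (J (base x)) + pair (D.lam (base x + D.gen i) i) (J (base x)) = 1 := by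
        rw [← pair_add_left]; exact hJ (base x)
      have key : pair (D.lam (base x) i) (fib x + J (base x)) +
            pair (D.lam (base x + D.gen i) i) (fib x + J (base x) + fib w) =
          pair (D.lam (base x) i) (fib x) + pair (D.lam (base x + D.gen i) i) (fib x + fib w) + 1 := by
        have e1 : pair (D.lam (base x) i) (fib x + J (base x)) +
              pair (D.lam (base x + D.gen i) i) (fib x + J (base x) + fib w) =
            pair (D.lam (base x) i) (fib x) + pair (D.lam (base x + D.gen i) i) (fib x + fib w) +
              (pair (D.lam (base x) i) (J (base x)) + pair (D.lam (base x + D.gen i) i) (J (base x))) := by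
          simp only [pair_add]
          abel
        rw [e1, hs]
      rw [key, fin2_add_one_eq_iff, not_not]
    have half : ∀ t₁ : V d₀ → V d₀ → Fin 2, 2 * dispCount (cfiMat D S t₁) w = Fintype.card (V (d₀ + r)) := by
      intro t₁
      refine two_mul_card_eq_of_flip _ τ hττ ?_
      intro x
      simp only [mem_filter, mem_univ, true_and]
      exact flip t₁ x
    have h1 := half t
    have h2 := half t'
    omega
  · -- `base w` is not a generator: the entries do not involve the twist
    unfold dispCount
    congr 1
    ext x
    simp only [mem_filter, mem_univ, true_and]
    rw [cfiMat_apply, cfiMat_apply]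
    have nogen : ∀ i', ¬ base (x + w) = base x + D.gen i' := by
      intro i' h
      rw [base_add] at h
      exact hw ⟨i', (add_left_cancel h).symm⟩
    constructor
    · rintro (h | ⟨i', hi', _⟩)
      · exact Or.inl h
      · exact absurd hi' (nogen i')
    · rintro (h | ⟨i', hi', _⟩)
      · exact Or.inl h
      · exact absurd hi' (nogen i')

/-- The instance for the conjecture `DisalignedPebble`'s pair: untwisted vs one edge twisted. -/
theorem dispCount_untwisted_eq_twisted (D : Design d₀ r δ) (hD : D.Good) (S : V d₀ → V r → Bool)
    (v₀ : V d₀) (i₀ : Fin δ) (w : V (d₀ + r)) :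
    dispCount (cfiMat D S fun _ _ => 0) w = dispCount (cfiMat D S (twist1 v₀ (v₀ + D.gen i₀))) w :=
  dispCount_cfiMat_eq D hD S _ _ w

end Summit.ValiantsHypothesis.ValiantsHypothesis.Theorems.SymmetryDialDisalignedCFIDisplacement
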